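import Summits.CriticalPhenomena.PercolationContinuityZ3.Theorems.PercNearOneGluingNoHeavyLowerTailAntitheticLiftCompositionShift
import Summits.CriticalPhenomena.PercolationContinuityZ3.Theorems.PercNearOneGluingNoHeavyLowerTailAntitheticOneSum
import HarnessLib

/-!
# `NoHeavyLowerTail` (stmt-CriticalPhenomena-4575) — antithetic cluster pairs: the 1-SUM LEMMA IN THE SHIFTED-BIC CLASS
# (`𝒮_shift = {F⁺(X) − F⁻(Y) : F⁻ ≤ F⁺ monotone}`-positivity of any `E₁`-event survives hanging an arbitrary graph at one vertex;
# prim-hp-2 gen 65, HOME/MEMO-gen65.md §2(d))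

Support file (`--supports stmt-CriticalPhenomena-4575`, hull-port prover `prim-hp-2`, gen 65).  No definitions, no named facts, no sorries;
standard axioms.  This is …AntitheticOneSum (gen 64) with the test class 𝒮 (twisted-monotone super-odd) replaced by the SMALLER class
`𝒮_shift` in hypothesis AND conclusion — the hypothesis is weaker (gen 65 showed `𝒮`-positivity can fail where the conjecture's
BIC-positivity holds: `K_{2,4}`, …AntitheticK24NotOplus), the conclusion still contains every BIC/shifted-BIC statement the handle
machinery consumes.  The proof is the gen-64 grafting argument verbatim, with `Antithetic.lift_composition_shift_filter_nonneg`
(…AntitheticLiftCompositionShift: `𝒮_shift` is closed under averaging over the exactly antipodal cluster cube of the hung graph).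
* `Antithetic.OneSumShift.event_sum_nonneg` — the lemma (setting and notation of `Antithetic.OneSum.event_sum_nonneg`).
[cite: VandenbergHaggstromKahn2005, §1 p. 6 ("Harris' inequality"), §1 p. 3 (open cluster `C_s`)]
-/

noncomputable section

namespace Summit.CriticalPhenomena.PercolationContinuityZ3.Theorems

open Literature.Probability.Percolation
open scoped Classical

namespace Antithetic

namespace OneSumShift

variable {V : Type*} {E₁ E₂ : Set (Sym2 V)} {s a : V}
  (hsep : ∀ e₁ ∈ E₁, ∀ e₂ ∈ E₂, ∀ v : V, v ∈ e₁ → v ∈ e₂ → v = a) (hs : ∀ e ∈ E₂, s ∈ e → s = a)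
include hsep hs

variable [Fintype V]

/-- **1-SUM LEMMA in the shifted-BIC class.**  `E₁, E₂` disjoint, glued at the single vertex `a`, source on the `E₁` side; `pred` an event
depending only on `ω ∩ E₁`.  If `Σ_{ω : pred ω} (F⁺(X_{E₁}) − F⁻(Y_{E₁}))(G⁺(X_{E₁}) − G⁻(Y_{E₁})) ≥ 0` for all monotone `F⁻ ≤ F⁺`, `G⁻ ≤ G⁺`, then
the same holds with the clusters of `E₁ ∪ E₂`. [this work] -/
theorem event_sum_nonneg (hdis : Disjoint E₁ E₂) (pred : Set (Sym2 V) → Prop) [DecidablePred pred]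
    (hpred : ∀ ω ω' : Set (Sym2 V), ω ∩ E₁ = ω' ∩ E₁ → (pred ω ↔ pred ω'))
    (hplus : ∀ Fp Fm Gp Gm : Set V → ℝ, Monotone Fp → Monotone Fm → (∀ S, Fm S ≤ Fp S) →
      Monotone Gp → Monotone Gm → (∀ S, Gm S ≤ Gp S) →
      0 ≤ ∑ ω ∈ Finset.univ.filter (fun ω : Set (Sym2 V) => pred ω),
        (Fp (openCluster (ω ∩ E₁) s) - Fm (openCluster (ωᶜ ∩ E₁) s)) * (Gp (openCluster (ω ∩ E₁) s) - Gm (openCluster (ωᶜ ∩ E₁) s)))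
    {Fp Fm Gp Gm : Set V → ℝ} (hFp : Monotone Fp) (hFm : Monotone Fm) (hF : ∀ S, Fm S ≤ Fp S)
    (hGp : Monotone Gp) (hGm : Monotone Gm) (hG : ∀ S, Gm S ≤ Gp S) :
    0 ≤ ∑ ω ∈ Finset.univ.filter (fun ω : Set (Sym2 V) => pred ω),
      (Fp (openCluster (ω ∩ (E₁ ∪ E₂)) s) - Fm (openCluster (ωᶜ ∩ (E₁ ∪ E₂)) s)) *
        (Gp (openCluster (ω ∩ (E₁ ∪ E₂)) s) - Gm (openCluster (ωᶜ ∩ (E₁ ∪ E₂)) s)) := by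
  -- notation
  let X₁ : Set (Sym2 V) → Set V := fun ω => openCluster (ω ∩ E₁) s
  let Y₁ : Set (Sym2 V) → Set V := fun ω => openCluster (ωᶜ ∩ E₁) s
  let A : Set (Sym2 V) → Set V := fun ω => openCluster (ω ∩ E₂) a
  let B : Set (Sym2 V) → Set V := fun ω => openCluster (ωᶜ ∩ E₂) a
  let L : Set V → Set V → Set V := fun P S => P ∪ {u | a ∈ P ∧ u ∈ S}
  let KK : Set V → Set V → ℝ := fun P Q => (Fp P - Fm Q) * (Gp P - Gm Q)
  let Ψ₂ : Set (Sym2 V) → Set (Sym2 V) → ℝ := fun ω₁ ω₂ =>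
    if pred ω₁ then KK (L (X₁ ω₁) (A ω₂)) (L (Y₁ ω₁) (B ω₂)) else 0
  have hdis' : ∀ e, e ∈ E₁ → e ∉ E₂ := fun e h1 h2 => Set.disjoint_left.1 hdis h1 h2
  -- (1) the target is the diagonal of `Ψ₂`
  have hdiag : ∑ ω ∈ Finset.univ.filter (fun ω : Set (Sym2 V) => pred ω),
      (Fp (openCluster (ω ∩ (E₁ ∪ E₂)) s) - Fm (openCluster (ωᶜ ∩ (E₁ ∪ E₂)) s)) *
        (Gp (openCluster (ω ∩ (E₁ ∪ E₂)) s) - Gm (openCluster (ωᶜ ∩ (E₁ ∪ E₂)) s)) = ∑ ω, Ψ₂ ω ω := by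
    rw [Finset.sum_filter]
    refine Finset.sum_congr rfl fun ω _ => ?_
    have e1 : openCluster (ω ∩ (E₁ ∪ E₂)) s = L (X₁ ω) (A ω) := OneSum.cluster_eq hsep hs ω
    have e2 : openCluster (ωᶜ ∩ (E₁ ∪ E₂)) s = L (Y₁ ω) (B ω) := OneSum.cluster_eq hsep hs ωᶜ
    rw [e1, e2]
  -- (2) grafting: the double sum is `|Set (Sym2 V)|` times the diagonal
  let θ : Set (Sym2 V) × Set (Sym2 V) → Set (Sym2 V) × Set (Sym2 V) :=
    fun p => ((p.1 \ E₂) ∪ (p.2 ∩ E₂), (p.2 \ E₂) ∪ (p.1 ∩ E₂))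
  have hθ : Function.Involutive θ := fun p => Cut.graft_graft E₂ p
  have g1 : ∀ c d : Set (Sym2 V), ((c \ E₂) ∪ (d ∩ E₂)) ∩ E₁ = c ∩ E₁ := by
    intro c d; ext e
    simp only [Set.mem_inter_iff, Set.mem_union, Set.mem_sdiff]
    constructor
    · rintro ⟨h | h, he⟩
      · exact ⟨h.1, he⟩
      · exact absurd h.2 (hdis' e he)
    · rintro ⟨hc, he⟩; exact ⟨Or.inl ⟨hc, hdis' e he⟩, he⟩
  have g2 : ∀ c d : Set (Sym2 V), ((c \ E₂) ∪ (d ∩ E₂))ᶜ ∩ E₁ = cᶜ ∩ E₁ := by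
    intro c d; ext e
    simp only [Set.mem_inter_iff, Set.mem_compl_iff, Set.mem_union, Set.mem_sdiff, not_or, not_and, not_not]
    constructor
    · rintro ⟨⟨h1, _⟩, he⟩; exact ⟨fun hc => hdis' e he (h1 hc), he⟩
    · rintro ⟨hc, he⟩; exact ⟨⟨fun hc' => absurd hc' hc, fun _ he2 => absurd he2 (hdis' e he)⟩, he⟩
  have hΨθ : ∀ p : Set (Sym2 V) × Set (Sym2 V), Ψ₂ p.1 p.2 = Ψ₂ (θ p).1 (θ p).1 := by
    intro p
    have a0 : pred (θ p).1 ↔ pred p.1 := hpred _ _ (g1 p.1 p.2)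
    have a1 : X₁ (θ p).1 = X₁ p.1 := by show openCluster (((p.1 \ E₂) ∪ (p.2 ∩ E₂)) ∩ E₁) s = _; rw [g1]
    have a2 : Y₁ (θ p).1 = Y₁ p.1 := by show openCluster (((p.1 \ E₂) ∪ (p.2 ∩ E₂))ᶜ ∩ E₁) s = _; rw [g2]
    have a3 : A (θ p).1 = A p.2 := by
      show openCluster (((p.1 \ E₂) ∪ (p.2 ∩ E₂)) ∩ E₂) a = _; rw [(Cut.graft_inter_right p.1 p.2).1]
    have a4 : B (θ p).1 = B p.2 := by
      show openCluster (((p.1 \ E₂) ∪ (p.2 ∩ E₂))ᶜ ∩ E₂) a = _; rw [(Cut.graft_inter_right p.1 p.2).2]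
    simp only [Ψ₂, a0, a1, a2, a3, a4]
  have hrel : ∑ ω₁, ∑ ω₂, Ψ₂ ω₁ ω₂ = (Fintype.card (Set (Sym2 V)) : ℝ) * ∑ ω, Ψ₂ ω ω := by
    rw [← Fintype.sum_prod_type']
    rw [show ∑ p : Set (Sym2 V) × Set (Sym2 V), Ψ₂ p.1 p.2 = ∑ p : Set (Sym2 V) × Set (Sym2 V), Ψ₂ (θ p).1 (θ p).1 from
      Fintype.sum_congr _ _ hΨθ]
    rw [Fintype.sum_bijective θ hθ.bijective (fun p => Ψ₂ (θ p).1 (θ p).1) (fun q => Ψ₂ q.1 q.1) (fun p => rfl)]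
    rw [Fintype.sum_prod_type, Finset.mul_sum]
    refine Finset.sum_congr rfl fun c _ => ?_
    show ∑ _d : Set (Sym2 V), Ψ₂ c c = _
    rw [Finset.sum_const, Finset.card_univ, nsmul_eq_mul]
  -- (3) the double sum is nonnegative: lift composition over the (exactly antipodal) cluster cube of `a` in `E₂`
  have hdbl : 0 ≤ ∑ ω₁, ∑ ω₂, Ψ₂ ω₁ ω₂ := by
    have hΦ : ∀ ω₁, ∑ ω₂, Ψ₂ ω₁ ω₂ =
        if pred ω₁ then ∑ ω₂, KK (L (X₁ ω₁) (A ω₂)) (L (Y₁ ω₁) (B ω₂)) else 0 := by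
      intro ω₁
      by_cases h : pred ω₁
      · simp only [Ψ₂, h, if_true]
      · simp only [Ψ₂, h, if_false, Finset.sum_const_zero]
    simp_rw [hΦ]
    rw [← Finset.sum_filter]
    refine lift_composition_shift_filter_nonneg pred X₁ Y₁ hplus (fun T P => L P (A T)) (fun T Q => L Q (B T))
      ?_ ?_ ?_ ?_ ?_ hFp hFm hF hGp hGm hG
    · -- monotone in the set
      intro T P P' hP u hu
      rcases hu with hu | ⟨ha, hu⟩
      · exact Or.inl (hP hu)
      · exact Or.inr ⟨hP ha, hu⟩
    · intro T Q Q' hQ u hu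
      rcases hu with hu | ⟨ha, hu⟩
      · exact Or.inl (hQ hu)
      · exact Or.inr ⟨hQ ha, hu⟩
    · -- `Φ` monotone in `T`
      intro P T T' hTT' u hu
      rcases hu with hu | ⟨ha, hu⟩
      · exact Or.inl hu
      · exact Or.inr ⟨ha, Freeze.openCluster_mono (Set.inter_subset_inter_left E₂ hTT') a hu⟩
    · -- `Ψ` antitone in `T`
      intro Q T T' hTT' u hu
      rcases hu with hu | ⟨ha, hu⟩
      · exact Or.inl hu
      · exact Or.inr ⟨ha, Freeze.openCluster_mono (Set.inter_subset_inter_left E₂ (Set.compl_subset_compl.2 hTT')) a hu⟩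
    · -- antipodal domination (with equality: `B Tᶜ = A T`)
      intro T P u hu
      rcases hu with hu | ⟨ha, hu⟩
      · exact Or.inl hu
      · refine Or.inr ⟨ha, ?_⟩
        have : B Tᶜ = A T := by show openCluster (Tᶜᶜ ∩ E₂) a = openCluster (T ∩ E₂) a; rw [compl_compl]
        rw [← this]; exact hu
  -- (4) conclude
  rw [hdiag]
  have hN : (0 : ℝ) < (Fintype.card (Set (Sym2 V)) : ℝ) := by exact_mod_cast Fintype.card_pos
  rw [hrel] at hdbl
  exact (mul_nonneg_iff_of_pos_left hN).1 hdbl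

end OneSumShift

end Antithetic

end Summit.CriticalPhenomena.PercolationContinuityZ3.Theorems
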